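import Mathlib
import Literature.Geometry.Manifold.TimeDerivativeSmooth

/-!
# The Hadamard quotient of a smooth function on `M × [0, ∞)` vanishing at `t = 0`

Stub `stub_hadamardQuotient` of the line `einstein-bulk-transfer` of the crux
`InformationMetricHadamard.AhHadamardFilling`: a function `f : M × ℝ → ℝ` that is `C^∞` on
`M × [0, ∞)` (within `univ ×ˢ Ici 0`) and vanishes on `M × {0}` factors as `f (x, t) = t · r (x, t)`
for `t ≥ 0` with `r` CONTINUOUS on all of `M × ℝ` and `r (x, 0) = ∂ₜ⁺ f (x, 0)`, the one-sided time
derivative.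

Proof (Hadamard's lemma in the time variable only): the one-sided time derivative
`g (x, t) := derivWithin (f (x, ·)) (Ici 0) t` is jointly continuous on `M × [0, ∞)` (tree
`Literature.Geometry.Manifold.continuousOn_derivWithin_time'`, any model with corners), hence
`G (x, t) := g (x, max t 0)` is continuous on `M × ℝ`; put `r (x, t) := ∫ θ in 0..1, G (x, θ t)`
(a continuous parametric integral). For `t ≥ 0` the substitution `s = θ t` and the fundamental
theorem of calculus on `[0, t]` (the slice `f (x, ·)` has derivative `g (x, s)` within `Ici 0`,
tree `hasDerivWithinAt_time_slice`) give `t · r (x, t) = ∫ s in 0..t, g (x, s) = f (x, t) - f (x, 0)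
= f (x, t)`, and `r (x, 0) = ∫ θ in 0..1, G (x, 0) = g (x, 0)`.
-/

noncomputable section

set_option linter.dupNamespace false

open scoped Manifold ContDiff Topology
open Set Function Bundle

namespace Summit.SmoothPoincare4.SmoothPoincare4.Cruxes.AhHadamardFilling.EinsteinBulkTransfer

open Literature.Geometry.Manifold

/-- **Hadamard quotient in the collar time.** A function `f : M × ℝ → ℝ`, `C^∞` on `M × [0, ∞)`
and zero on `M × {0}`, is `t` times a continuous function `r` on `t ≥ 0`, with `r (x, 0)` the
one-sided time derivative `derivWithin (f (x, ·)) (Ici 0) 0`. [folklore] -/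
theorem stub_hadamardQuotient
    (M : Type) [TopologicalSpace M] [T2Space M] [SecondCountableTopology M]
    [ChartedSpace (EuclideanSpace ℝ (Fin 4)) M] [IsManifold (𝓡 4) ∞ M]
    (f : M × ℝ → ℝ) (hf : ContMDiffOn ((𝓡 4).prod 𝓘(ℝ, ℝ)) 𝓘(ℝ, ℝ) ∞ f (univ ×ˢ Ici 0))
    (hf0 : ∀ x : M, f (x, 0) = 0) :
    ∃ r : M × ℝ → ℝ, Continuous r ∧ (∀ (x : M) (t : ℝ), 0 ≤ t → f (x, t) = t * r (x, t)) ∧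
      ∀ x : M, r (x, 0) = derivWithin (fun t => f (x, t)) (Ici 0) 0 := by
  -- `f` read as the family of its time slices `u s x := f (x, s)`, `C^∞` on `M × [0, ∞)`
  have hu : ContMDiffOn ((𝓡 4).prod 𝓘(ℝ, ℝ)) 𝓘(ℝ, ℝ) ∞
      (fun p : M × ℝ => (fun (s : ℝ) (x : M) => f (x, s)) p.2 p.1) (univ ×ˢ Ici 0) := hf
  -- the one-sided time derivative `g`, jointly continuous on `M × [0, ∞)`
  set g : M × ℝ → ℝ := fun p => derivWithin (fun s => f (p.1, s)) (Ici 0) p.2 with hg_def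
  have hg : ContinuousOn g (univ ×ˢ Ici 0) :=
    continuousOn_derivWithin_time' (I := 𝓡 4) (u := fun (s : ℝ) (x : M) => f (x, s))
      (uniqueDiffOn_Ici 0) hu
  -- its continuous extension `G` to `M × ℝ` through the retraction `t ↦ max t 0`
  set G : M × ℝ → ℝ := fun p => g (p.1, max p.2 0) with hG_def
  have hG : Continuous G :=
    hg.comp_continuous (continuous_fst.prodMk (continuous_snd.max continuous_const))
      fun p => ⟨mem_univ _, mem_Ici.2 (le_max_right _ _)⟩
  have hGg : ∀ (x : M) (t : ℝ), 0 ≤ t → G (x, t) = g (x, t) := fun x t ht => by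
    simp only [hG_def, max_eq_left ht]
  -- the Hadamard quotient `r (x, t) := ∫ θ in 0..1, G (x, θ t)`
  refine ⟨fun p => ∫ θ in (0 : ℝ)..1, G (p.1, θ * p.2), ?_, ?_, ?_⟩
  · -- continuity of a parametric integral with jointly continuous integrand
    have hF : Continuous (Function.uncurry fun (p : M × ℝ) (θ : ℝ) => G (p.1, θ * p.2)) :=
      hG.comp ((continuous_fst.comp continuous_fst).prodMk
        (continuous_snd.mul (continuous_snd.comp continuous_fst)))
    exact intervalIntegral.continuous_parametric_intervalIntegral_of_continuous' hF 0 1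
  · intro x t ht
    -- `t * ∫ θ in 0..1, G (x, θ t) = ∫ s in 0..t, G (x, s) = f (x, t) - f (x, 0) = f (x, t)`
    have h1 : t * ∫ θ in (0 : ℝ)..1, G (x, θ * t) = ∫ s in (0 : ℝ)..t, G (x, s) := by
      have h := intervalIntegral.smul_integral_comp_mul_right (a := 0) (b := 1)
        (fun s => G (x, s)) t
      simpa only [zero_mul, one_mul, smul_eq_mul] using h
    have hcont : ContinuousOn (fun s => f (x, s)) (Icc 0 t) := by
      have hι : Continuous fun s : ℝ => ((x, s) : M × ℝ) := continuous_const.prodMk continuous_id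
      exact (hf.continuousOn.comp hι.continuousOn fun s hs => ⟨mem_univ _, hs⟩).mono
        Icc_subset_Ici_self
    have hderiv : ∀ s ∈ Ioo 0 t, HasDerivWithinAt (fun s => f (x, s)) (G (x, s)) (Ioi s) s := by
      intro s hs
      rw [hGg x s hs.1.le]
      exact (hasDerivWithinAt_time_slice (I := 𝓡 4) (u := fun (s : ℝ) (x : M) => f (x, s)) hu x
        (show s ∈ Ici (0 : ℝ) from hs.1.le)).mono (Ioi_subset_Ici hs.1.le)
    have h2 := intervalIntegral.integral_eq_sub_of_hasDeriv_right_of_le ht hcont hderiv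
      ((hG.comp (continuous_const.prodMk continuous_id)).intervalIntegrable 0 t)
    change f (x, t) = t * ∫ θ in (0 : ℝ)..1, G (x, θ * t)
    rw [h1, h2, hf0, sub_zero]
  · intro x
    change ∫ θ in (0 : ℝ)..1, G (x, θ * 0) = g (x, 0)
    simp only [mul_zero, intervalIntegral.integral_const, sub_zero, one_smul]
    exact hGg x 0 le_rfl

end Summit.SmoothPoincare4.SmoothPoincare4.Cruxes.AhHadamardFilling.EinsteinBulkTransfer

end
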